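import Summits.QuantumFields.YangMills.Theorems.BalabanUVNodesN15KingModelTheorem21TwoPoint

/-!
# BalabanUVNodes ∕ N15 — THE KING-MODEL RUNG (PART Ϝ-h): EXACT ZERO-MOMENTUM SUM RULES FOR THE FREE FIELD —
# `Σ_{b′} S₂^{(K)}(b, b′) = m⁻²` AT EVERY `K`, `Σ_{b′} S₂^{(∞)}(b, b′) = m⁻²`, `Σ_{b′} (Δ^{(K)})⁻¹(b, b′) = a_K⁻¹ + m⁻²`, and constant sources: `ln Z_η(Ω, j₀) = j₀²|Ω|∕(2m²)`
# (Track A, DAG node N15 = NE2; FAN-OUT v1.1 §N15 s3 «KING-MODEL RUNG … NE2's analogue DECIDED in the model»)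

HONEST FRAMING.  Count-neutral (cell `pub-ymgap`, seat `pub-ymgap-dag-n15-e` g33; `--supports stmt-QuantumFields-27366 --as helper` = K3⁸
`SpineGivenEndpointR13SepCoPHV`).  TEMPLATE LITERATURE: C. King, *The U(1) Higgs model. I. The continuum limit*, Commun. Math. Phys. **102** (1986) 649–677
[King1986] — KING's OWN `A = 0`, `g = 0` MODEL (free massive lattice scalar field) on the fine tori over every unit torus `Ω = Tor M`.  NOT the U(1) Higgs model;
NOT Bałaban's objects; NOT a node discharge (N15 is booked through n15-a's knit, untouched here); nothing continuum-Yang–Mills ∕ ℝ⁴ ∕ OS ∕ mass-gap ∕ Clay.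
0 `sorry`; standard axioms; 0 `def`.

THE MATHEMATICS.  The block-smeared Schwinger function and its limit are plane-wave kernels `|Ω|⁻¹Σ_q w(q)Re e^{iq·(b′−b)}` (parts Ϝ-d, Ϡ-d) with `w = S_N`, resp. `S_∞∘p′`.
Summing over `b′` kills every mode but `q = 0` (`Σ_x e^{iq·x} = |Ω|[q = 0]`, tree `sum_chi_left`), and the zero mode is EXACT: `S_N(0) = m⁻²` (tree `Sfib_zero`: the central
alias term is `|u(0)|²∕σ(0) = 1∕m²`, the others vanish since `u(2πk∕N·N) = 0`) and `S_∞(0) = m⁻²` (part Ϡ-h `aliasSeries0_zero`).  Hence the STATIC SUSCEPTIBILITY SUM RULE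
`Σ_{b′} S₂^{(K)}(b,b′) = m⁻²` at EVERY level `K` and in the limit — the free mass is not renormalised by the block-spin transformation — and, adding the white noise of part
Ϛ, `Σ_{b′}(Δ^{(K)})⁻¹(b,b′) = a_K⁻¹ + m⁻²`, `Σ_{b′} C^{(∞)}(b,b′) = a_∞⁻¹ + m⁻²`.  A CONSTANT source `h ≡ j₀` therefore has `ln Z_η(Ω, j₀) = ½j₀²Σ_{b,b′}S₂ = j₀²|Ω|∕(2m²)`
EXACTLY, independently of `η` — Theorem 2.1's (2.23) with EQUALITY (`C = j₀²∕(2m²)`), and (2.22) trivially; the diagonal `S₂^{(K)}(b,b) = |Ω|⁻¹Σ_q S_N(q)` is the normalised trace.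

WHAT THIS FILE PROVES (kernel).  §1 `sum_re_chi_sub` (`Σ_{b′} Re e^{iq·(b′−b)} = |Ω|[q=0]`), ★ `sum_fourierKernel_eq` (`Σ_{b′}|Ω|⁻¹Σ_q w(q)Re e^{iq·(b′−b)} = w(0)`, every weight).
§2 ★★ **`sum_kingS2_eq`** (`Σ_{b′}S₂^{(K)}(b,b′) = m⁻²`), ★★ **`sum_kingS2Lim_eq`** (`= m⁻²`), ★ `sum_effLaplacian_inv_eq` (`Σ_{b′}(Δ_eff)⁻¹(b,b′) = a⁻¹ + m⁻²`, every `a > 0`),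
★ `sum_blockCov_eq` (`a_K⁻¹ + m⁻²`), ★ `sum_blockCovLim_eq` (`a_∞⁻¹ + m⁻²`), `kingS2_diag_eq` (trace formula), `sum_sum_kingS2_eq` (`Σ_{b,b′} = |Ω|m⁻²`).  §2b (volume-free
summed bounds, tree `tdistT_sumBound`): ★★ **`sum_abs_kingS2_sub_lim_le`** (`Σ_{b′}|S₂^{(K)} − S₂^{(∞)}| ≤ (2C_diff + a_∞⁻¹)K_{d+1}(κ_M∕2)L^{−K}` — the (4.38) rate in operator
norm, Thm 3.3 (3.7)'s shape), ★ `abs_sum_kingS2_sub_lim_mul_le` (smeared observables), ★ `sum_abs_kingS2Lim_le` (`Σ_{b′}|S₂^{(∞)}| ≤ m⁻² + (2∕γ_m)K_{d+1}(κ_M)`).  §3 `blockSrc_const`,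
★★ **`log_kingFineZ_const`** (`ln Z_η(Ω, j₀) = j₀²|Ω|∕(2m²)`), ★ `log_kingFineZ_const_eq_bound` ((2.23) is attained: the bound `H²∕(2m²)·|Ω|` of part Ϝ-a is sharp).

HONEST SCOPE.  Exact identities of King's free `A = 0` model on finite tori; every `N ≥ 1`, every unit torus, `m² > 0`.  N15 untouched; counts unmoved.
Locators: [King1986] (2.13)–(2.14) p.653, Thm 2.1 (2.22)–(2.23) p.654, (4.5) p.670, (4.9)–(4.12) p.671, (4.35) p.674.
-/

noncomputable section

open scoped BigOperators ComplexConjugate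
open Finset Matrix Complex

namespace Summit.QuantumFields.YangMills.BalabanUVNodes.N15KingModelRung

open Literature.MathematicalPhysics.QuantumFieldTheory.Balaban1983to89.B5Prop11Plancherel (Tor fine chi sOf sOf_zero chi_zero_left)
open Literature.MathematicalPhysics.QuantumFieldTheory.King1986 (aK aK_pos)
open Literature.MathematicalPhysics.QuantumFieldTheory.King1986.Torus

variable {d : ℕ}

/-! ## §1 Summing a plane-wave kernel over one argument keeps only the zero mode -/

section Kernel

variable (M : Fin d → ℕ) [hM : ∀ μ, NeZero (M μ)]

/-- `Σ_{b′} Re e^{iq·(b′−b)} = |Ω|·[q = 0]` (character orthogonality, tree `sum_chi_left`). [cite: King1986, (4.35) p.674] -/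
theorem sum_re_chi_sub (q b : Tor M) : ∑ b' : Tor M, (chi M q (b' - b)).re = if q = 0 then (Fintype.card (Tor M) : ℝ) else 0 := by
  rw [← Complex.re_sum]
  have h : ∑ b' : Tor M, chi M q (b' - b) = ∑ x : Tor M, chi M q x :=
    Fintype.sum_equiv (Equiv.subRight b) _ _ fun _ => rfl
  rw [h]
  have h2 : ∑ x : Tor M, chi M q x = ∑ x : Tor M, chi M x q := Finset.sum_congr rfl fun x _ => chi_comm M q x
  rw [h2, sum_chi_left]
  split_ifs
  · exact Complex.natCast_re _
  · exact Complex.zero_re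

/-- ★ **ZERO-MODE EXTRACTION**: `Σ_{b′} |Ω|⁻¹Σ_q w(q)Re e^{iq·(b′−b)} = w(0)` for every weight `w`. [cite: King1986, (4.35) p.674] -/
theorem sum_fourierKernel_eq (w : Tor M → ℝ) (b : Tor M) :
    ∑ b' : Tor M, (Fintype.card (Tor M) : ℝ)⁻¹ * ∑ q : Tor M, w q * (chi M q (b' - b)).re = w 0 := by
  have hcard : (Fintype.card (Tor M) : ℝ) ≠ 0 := by exact_mod_cast Fintype.card_ne_zero
  rw [← Finset.mul_sum, Finset.sum_comm]
  simp_rw [← Finset.mul_sum, sum_re_chi_sub M, mul_ite, mul_zero]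
  rw [Finset.sum_ite_eq' Finset.univ (0 : Tor M)]
  simp only [Finset.mem_univ, if_true]
  field_simp

end Kernel

/-! ## §2 The susceptibility sum rules -/

section SumRules

variable (N : ℕ) [NeZero N] (M : Fin d → ℕ) [hM : ∀ μ, NeZero (M μ)]

/-- ★★ **THE STATIC SUSCEPTIBILITY SUM RULE AT EVERY LEVEL**: `Σ_{b′} S₂^{(K)}(b,b′) = m⁻²` (`N ≥ 1`, `m² > 0`) — only `q = 0` survives and `S_N(0) = m⁻²` exactly.
[cite: King1986, (4.5) p.670, (4.9)–(4.12) p.671, (2.14) p.653] -/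
theorem sum_kingS2_eq (hN1 : 1 ≤ N) {m2 : ℝ} (hm : 0 < m2) (b : Tor M) : ∑ b' : Tor M, kingS2 N M m2 b b' = m2⁻¹ := by
  simp_rw [kingS2_eq_fourier N M hm]
  rw [sum_fourierKernel_eq M, Literature.MathematicalPhysics.QuantumFieldTheory.Balaban1983to89.Beta.WoodburyFibre.Sfib_zero N M hN1, one_div]

/-- The double sum: `Σ_{b,b′} S₂^{(K)}(b,b′) = |Ω|·m⁻²`. [cite: King1986, (2.14) p.653] -/
theorem sum_sum_kingS2_eq (hN1 : 1 ≤ N) {m2 : ℝ} (hm : 0 < m2) :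
    ∑ b : Tor M, ∑ b' : Tor M, kingS2 N M m2 b b' = Fintype.card (Tor M) * m2⁻¹ := by
  simp_rw [sum_kingS2_eq N M hN1 hm]
  rw [Finset.sum_const, Finset.card_univ, nsmul_eq_mul]

/-- THE TRACE FORMULA: the diagonal is site-independent, `S₂^{(K)}(b,b) = |Ω|⁻¹Σ_q S_N(q)`. [cite: King1986, (4.35) p.674] -/
theorem kingS2_diag_eq {m2 : ℝ} (hm : 0 < m2) (b : Tor M) :
    kingS2 N M m2 b b = (Fintype.card (Tor M) : ℝ)⁻¹ * ∑ q : Tor M, Sfib N M ((N : ℝ) ^ 2) m2 q := by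
  rw [kingS2_eq_fourier N M hm]
  simp [sub_self, chi_zero_right_eq]
  where
  /-- `e^{iq·0} = 1`. [folklore] -/
  chi_zero_right_eq (q : Tor M) : chi M q 0 = 1 := by rw [chi_comm, chi_zero_left]

/-- ★ `Σ_{b′}(Δ_eff)⁻¹(b,b′) = a⁻¹ + m⁻²` for every `a > 0` (the white noise adds `a⁻¹`). [cite: King1986, (2.13)–(2.14) p.653] -/
theorem sum_effLaplacian_inv_eq (hN1 : 1 ≤ N) {a m2 : ℝ} (ha : 0 < a) (hm : 0 < m2) (b : Tor M) :
    ∑ b' : Tor M, (effLaplacian N M a ((N : ℝ) ^ 2) m2)⁻¹ b b' = a⁻¹ + m2⁻¹ := by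
  have h : ∀ b', (effLaplacian N M a ((N : ℝ) ^ 2) m2)⁻¹ b b' = kingS2 N M m2 b b' + a⁻¹ * (if b = b' then 1 else 0) := fun b' => by
    rw [kingS2_eq_effLaplacian_inv_sub N M hN1 ha hm]; ring
  simp_rw [h, Finset.sum_add_distrib, sum_kingS2_eq N M hN1 hm, mul_ite, mul_one, mul_zero, Finset.sum_ite_eq, Finset.mem_univ, if_true]
  ring

end SumRules

section SumRulesTorus

variable (L : ℕ) [NeZero L] (M : Fin (d + 1) → ℕ) [hM : ∀ μ, NeZero (M μ)]

/-- ★ `Σ_{b′}(Δ^{(K)})⁻¹(b,b′) = a_K⁻¹ + m⁻²` (`K ≥ 1`, `L ≥ 2`). [cite: King1986, (2.13)–(2.14) p.653] -/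
theorem sum_blockCov_eq (hL : 2 ≤ L) {a m2 : ℝ} (ha : 0 < a) (hm : 0 < m2) {K : ℕ} (hK : 1 ≤ K) (b : Tor M) :
    ∑ b' : Tor M, blockCov L (L ^ K) M a m2 K b b' = (aK a L K)⁻¹ + m2⁻¹ := by
  have hL1 : (1 : ℝ) < L := by exact_mod_cast (show 1 < L by omega)
  have hLK : 1 ≤ L ^ K := Nat.one_le_pow K L (by omega)
  unfold blockCov
  exact sum_effLaplacian_inv_eq (L ^ K) M hLK (aK_pos ha hL1 hK) hm b

omit [NeZero L] in
/-- ★★ **THE SUM RULE IN THE CONTINUUM LIMIT**: `Σ_{b′} S₂^{(∞)}(b,b′) = m⁻²` (`S_∞(0) = m⁻²`, part Ϡ-h). [cite: King1986, Thm 2.1 (2.22) p.654, (4.5) p.670] -/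
theorem sum_kingS2Lim_eq (m2 : ℝ) (b : Tor M) : ∑ b' : Tor M, kingS2Lim M m2 b b' = m2⁻¹ := by
  unfold kingS2Lim
  rw [sum_fourierKernel_eq M (fun q => aliasSeries0 m2 (sOf M q)) b]
  simp only [sOf_zero, aliasSeries0_zero]

omit [NeZero L] in
/-- ★ `Σ_{b′} C^{(∞)}(b,b′) = a_∞⁻¹ + m⁻²`. [cite: King1986, (2.14) p.653, Thm 2.1 (2.22) p.654] -/
theorem sum_blockCovLim_eq (a m2 : ℝ) (b : Tor M) : ∑ b' : Tor M, blockCovLim L M a m2 b b' = (aInf a L)⁻¹ + m2⁻¹ := by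
  have h : ∀ b', blockCovLim L M a m2 b b' = kingS2Lim M m2 b b' + (aInf a L)⁻¹ * (if b = b' then 1 else 0) := fun b' => by
    rw [kingS2Lim_eq_blockCovLim_sub L M a m2]; ring
  simp_rw [h, Finset.sum_add_distrib, sum_kingS2Lim_eq M, mul_ite, mul_one, mul_zero, Finset.sum_ite_eq, Finset.mem_univ, if_true]
  ring

end SumRulesTorus

/-! ## §2b Summed (operator-norm) bounds, volume-free: Thm 3.3 (3.7)'s shape for the Schwinger function and its (4.38) rate -/

section Operator

variable (L : ℕ) (M : Fin (d + 1) → ℕ) [hM : ∀ μ, NeZero (M μ)]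

/-- ★★ **THE (4.38) RATE IN OPERATOR (`ℓ¹`∕`ℓ^∞`) NORM, VOLUME-FREE**: for odd `L ≥ 2`, `a, m² > 0`, `K ≥ 1` and every row `b`,
`Σ_{b′}|S₂^{(K)}(b,b′) − S₂^{(∞)}(b,b′)| ≤ (2C_diff + a_∞⁻¹)·K_{d+1}(κ_M∕2)·L^{−K}` — part Ϝ-d's kernel rate summed with the tree's uniform lattice sums `tdistT_sumBound`.
[cite: King1986, Thm 3.3 (3.7) p.655, Lemma 4.5 (4.38) p.674] -/
theorem sum_abs_kingS2_sub_lim_le (hLodd : Odd L) (hL : 2 ≤ L) {a m2 : ℝ} (ha : 0 < a) (hm : 0 < m2) {K : ℕ} (hK : 1 ≤ K) (b : Tor M) :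
    haveI : NeZero L := ⟨by omega⟩
    ∑ b' : Tor M, |kingS2 (L ^ K) M m2 b b' - kingS2Lim M m2 b b'|
      ≤ (2 * CdiffM (d + 1) a m2 L + (aInf a L)⁻¹)
          * Literature.MathematicalPhysics.QuantumFieldTheory.Balaban1983to89.B4Sect5Proof.latticeConst (d + 1) (kapM (d + 1) a m2 L / 2) * ((L : ℝ) ^ K)⁻¹ := by
  haveI : NeZero L := ⟨by omega⟩
  have hL1 : (1 : ℝ) < L := by exact_mod_cast (show 1 < L by omega)
  have hC : 0 ≤ 2 * CdiffM (d + 1) a m2 L + (aInf a L)⁻¹ := by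
    have := CdiffM_nonneg (d := d + 1) ha hm hL
    have := aInf_pos ha hL1
    positivity
  have hκ : 0 < kapM (d + 1) a m2 L / 2 := half_pos (kapM_pos_le (d := d + 1) ha hm hL).1
  have hsum := tdistT_sumBound M (kapM (d + 1) a m2 L / 2) hκ b
  calc ∑ b' : Tor M, |kingS2 (L ^ K) M m2 b b' - kingS2Lim M m2 b b'|
      ≤ ∑ b' : Tor M, (2 * CdiffM (d + 1) a m2 L + (aInf a L)⁻¹) * Real.exp (-(kapM (d + 1) a m2 L / 2 * tdistT M b b')) * ((L : ℝ) ^ K)⁻¹ :=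
        Finset.sum_le_sum fun b' _ => abs_kingS2_sub_lim_le L M hLodd hL ha hm hK b b'
    _ = (2 * CdiffM (d + 1) a m2 L + (aInf a L)⁻¹) * (∑ b' : Tor M, Real.exp (-(kapM (d + 1) a m2 L / 2 * tdistT M b b'))) * ((L : ℝ) ^ K)⁻¹ := by
        rw [Finset.mul_sum, Finset.sum_mul]
    _ ≤ (2 * CdiffM (d + 1) a m2 L + (aInf a L)⁻¹)
          * Literature.MathematicalPhysics.QuantumFieldTheory.Balaban1983to89.B4Sect5Proof.latticeConst (d + 1) (kapM (d + 1) a m2 L / 2) * ((L : ℝ) ^ K)⁻¹ := by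
        gcongr

/-- ★ **SMEARED OBSERVABLES CONVERGE UNIFORMLY IN THE VOLUME**: for a bounded `J` (`|J| ≤ H`), `|Σ_{b′}(S₂^{(K)} − S₂^{(∞)})(b,b′)J(b′)| ≤ (2C_diff + a_∞⁻¹)K_{d+1}(κ_M∕2)·H·L^{−K}`.
[cite: King1986, Thm 2.1 (2.22) p.654, Thm 3.3 (3.7) p.655] -/
theorem abs_sum_kingS2_sub_lim_mul_le (hLodd : Odd L) (hL : 2 ≤ L) {a m2 : ℝ} (ha : 0 < a) (hm : 0 < m2) {K : ℕ} (hK : 1 ≤ K) {J : Tor M → ℝ} {H : ℝ}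
    (hJ : ∀ b, |J b| ≤ H) (b : Tor M) :
    haveI : NeZero L := ⟨by omega⟩
    |∑ b' : Tor M, (kingS2 (L ^ K) M m2 b b' - kingS2Lim M m2 b b') * J b'|
      ≤ (2 * CdiffM (d + 1) a m2 L + (aInf a L)⁻¹)
          * Literature.MathematicalPhysics.QuantumFieldTheory.Balaban1983to89.B4Sect5Proof.latticeConst (d + 1) (kapM (d + 1) a m2 L / 2) * ((L : ℝ) ^ K)⁻¹ * H := by
  haveI : NeZero L := ⟨by omega⟩
  have hH : 0 ≤ H := (abs_nonneg _).trans (hJ b)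
  have h1 := sum_abs_kingS2_sub_lim_le L M hLodd hL ha hm hK b
  calc |∑ b' : Tor M, (kingS2 (L ^ K) M m2 b b' - kingS2Lim M m2 b b') * J b'|
      ≤ ∑ b' : Tor M, |(kingS2 (L ^ K) M m2 b b' - kingS2Lim M m2 b b') * J b'| := Finset.abs_sum_le_sum_abs _ _
    _ ≤ ∑ b' : Tor M, |kingS2 (L ^ K) M m2 b b' - kingS2Lim M m2 b b'| * H := Finset.sum_le_sum fun b' _ => by
        rw [abs_mul]; exact mul_le_mul_of_nonneg_left (hJ b') (abs_nonneg _)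
    _ = (∑ b' : Tor M, |kingS2 (L ^ K) M m2 b b' - kingS2Lim M m2 b b'|) * H := by rw [Finset.sum_mul]
    _ ≤ _ := mul_le_mul_of_nonneg_right h1 hH

/-- ★ **ABSOLUTE SUSCEPTIBILITY OF THE LIMIT, VOLUME-FREE**: `Σ_{b′}|S₂^{(∞)}(b,b′)| ≤ m⁻² + (2∕γ_m)K_{d+1}(κ_M)` (diagonal `≤ m⁻²`, Thm 3.3 decay elsewhere).
[cite: King1986, Thm 3.3 (3.6)–(3.7) p.655] -/
theorem sum_abs_kingS2Lim_le (hLodd : Odd L) (hL : 2 ≤ L) {a m2 : ℝ} (ha : 0 < a) (hm : 0 < m2) (b : Tor M) :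
    ∑ b' : Tor M, |kingS2Lim M m2 b b'|
      ≤ m2⁻¹ + 2 / gamM a m2 L * Literature.MathematicalPhysics.QuantumFieldTheory.Balaban1983to89.B4Sect5Proof.latticeConst (d + 1) (kapM (d + 1) a m2 L) := by
  classical
  have hκ : 0 < kapM (d + 1) a m2 L := (kapM_pos_le (d := d + 1) ha hm hL).1
  have hγ : 0 < gamM a m2 L := gamM_pos ha hm hL
  have hsum := tdistT_sumBound M (kapM (d + 1) a m2 L) hκ b
  rw [← Finset.add_sum_erase _ _ (Finset.mem_univ b)]
  refine add_le_add (abs_kingS2Lim_le L M hLodd hL hm b b) ?_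
  calc ∑ b' ∈ Finset.univ.erase b, |kingS2Lim M m2 b b'|
      ≤ ∑ b' ∈ Finset.univ.erase b, 2 / gamM a m2 L * Real.exp (-(kapM (d + 1) a m2 L * tdistT M b b')) :=
        Finset.sum_le_sum fun b' hb' => abs_kingS2Lim_le_decay L M hLodd hL ha hm (Ne.symm (Finset.ne_of_mem_erase hb'))
    _ ≤ ∑ b' : Tor M, 2 / gamM a m2 L * Real.exp (-(kapM (d + 1) a m2 L * tdistT M b b')) :=
        Finset.sum_le_sum_of_subset_of_nonneg (Finset.erase_subset _ _) fun _ _ _ => by positivity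
    _ = 2 / gamM a m2 L * ∑ b' : Tor M, Real.exp (-(kapM (d + 1) a m2 L * tdistT M b b')) := by rw [Finset.mul_sum]
    _ ≤ 2 / gamM a m2 L * Literature.MathematicalPhysics.QuantumFieldTheory.Balaban1983to89.B4Sect5Proof.latticeConst (d + 1) (kapM (d + 1) a m2 L) :=
        mul_le_mul_of_nonneg_left hsum (by positivity)

end Operator

/-! ## §3 Constant sources: (2.23) with equality -/

section Const

variable (N : ℕ) [NeZero N] (M : Fin d → ℕ) [hM : ∀ μ, NeZero (M μ)]

/-- A constant block source is a constant fine source. [folklore] -/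
theorem blockSrc_const (j₀ : ℝ) : blockSrc N M (fun _ => j₀) = fun _ => j₀ := rfl

/-- ★★ **CONSTANT SOURCES ARE EXACT**: `ln Z_η(Ω, j₀) = j₀²|Ω|∕(2m²)` at EVERY `η` (only the zero mode, `S_N(0) = m⁻²`). [cite: King1986, Thm 2.1 (2.22)–(2.23) p.654, (4.5) p.670] -/
theorem log_kingFineZ_const (hN1 : 1 ≤ N) {m2 : ℝ} (hm : 0 < m2) (j₀ : ℝ) :
    Real.log (kingFineZ N M m2 (fun _ => j₀)) = j₀ ^ 2 / (2 * m2) * Fintype.card (Tor M) := by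
  rw [← blockSrc_const N M j₀, log_kingFineZ_blockSrc_eq_sum₂ N M hm]
  have h : ∑ b : Tor M, ∑ b' : Tor M, j₀ * kingS2 N M m2 b b' * j₀ = j₀ ^ 2 * (Fintype.card (Tor M) * m2⁻¹) := by
    rw [← sum_sum_kingS2_eq N M hN1 hm, Finset.mul_sum]
    refine Finset.sum_congr rfl fun b _ => ?_
    rw [Finset.mul_sum]
    refine Finset.sum_congr rfl fun b' _ => ?_
    ring
  rw [h]
  field_simp

/-- ★ Part Ϝ-a's extensive bound `ln Z ≤ H²∕(2m²)·|Ω|` is ATTAINED by the constant source `J ≡ H`. [cite: King1986, Thm 2.1 (2.23) p.654] -/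
theorem log_kingFineZ_const_eq_bound (hN1 : 1 ≤ N) {m2 : ℝ} (hm : 0 < m2) (H : ℝ) :
    Real.log (kingFineZ N M m2 (blockSrc N M (fun _ => H))) = H ^ 2 / (2 * m2) * Fintype.card (Tor M) := by
  rw [blockSrc_const, log_kingFineZ_const N M hN1 hm]

end Const

end Summit.QuantumFields.YangMills.BalabanUVNodes.N15KingModelRung

end
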